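import Summits.ResolutionOfSingularities.ResolutionOfSingularities.Theorems.MarkedTransferCampaignW46MohWindowShadeFormalInsepCore
import HarnessLib

/-!
# [OURS · L1 W4.6 rung (iii-2), FORMAL ENTRANCE DOOR for POWER-SERIES residuals, brick 2a] The RING-LEVEL formal step for series anchors:
# the controlled transform of `z^p + F(u)`, `F ∈ K⟦u⟧`, at a rational point of the point blow-up is anchored by the SERIES STEP

Cell `res-hironaka`, LADDER-RESOLUTION rung L (D-0089), slot W4.6 rung (iii); seat res-L1-s46-pv-6 (gen 6). Host route MarkedTransfer,
`--supports stmt-ResolutionOfSingularities-16155 --as helper`; kind proof (no definition).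

WHAT. Series twin of gen 5's `MohWindowShadeFormalStep.exists_ringEquiv_transform_anchor` (p529787): same hypotheses (local homomorphism
`g : R → L`, Cohen coordinates `E₀` with adapted generators `c`, chart data at the rational point in the chart `u_{i₀}`, Hauser–Wagner frame
condition, controlled transform `g f₀ = g(c_{i₀})^p · f′` with `f′ ∈ 𝔪_L^p`), but the anchor is `E₀(f₀) = w₀ · (z^p + F(u))` with `F` an ARBITRARY
POWER SERIES of order `≥ p` (a series state `S₀` of `…MohWindowShadePSModel`), and the conclusion anchors `f′` by the SERIES STEP:
`E′(f′) = w′ · (z^p + F′(u))`, `F′ = (S₀.step p i₀ b).F`, at an equimultiple point `b` of the series model. The proof is gen 5's with the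
polynomial identity replaced by `Series.subst_chartSubst_eq` (brick 0) read through pv-2's germ substitution `ringHom_eq_subst_chartGerm`,
and the cleaning shear chosen from `Series.exists_add_pow_eq_step_F`. OURS; NOT a statement of the manuscript [claim: Hironaka2017,
status: under-review] (Def. 2.1 p.5, Th. 16.6 p.84 — scope only), nothing of which is used. AI review is weaker than expert review.
References: H. Matsumura, *Commutative Ring Theory* (1986), Thm. 8.11; H. Hauser, Bull. AMS 47 (2010) §§F–G. [Matsumura1987] [Hauser2010]
-/

noncomputable section

set_option linter.dupNamespace false -- mandated namespace of this single-conjunct summit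

open IsLocalRing MvPolynomial

namespace Summit.ResolutionOfSingularities.ResolutionOfSingularities.Theorems

namespace CampaignW46

namespace MohWindowShadeFormalInsep

open Literature.AlgebraicGeometry.Resolution
open Literature.AlgebraicGeometry.Resolution.PointBlowup
open Literature.AlgebraicGeometry.Resolution.Hauser2010
open MohWindowShadePS
open CampaignW46.FormalChart
open CampaignW46.AtomGerm (hasSubst_chartGerm ringHom_eq_subst_chartGerm rename_chartSubst_self rename_chartSubst_of_ne subst_chartGerm_rename
  exists_isUnit_image_adapted X_some_ne_zero kill_rename_some kill_rename_sub_C constantCoeff_rename_some mem_maximalIdeal_pow_iff_algebraMap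
  mem_maximalIdeal_pow_of_rename_some)
open Literature.RingTheory.MvPowerSeries.Jets (mem_maximalIdeal_iff_constantCoeff_eq_zero le_order_of_mem_maximalIdeal_pow)
open Summit.ResolutionOfSingularities.ResolutionOfSingularities.Theorems.FrobeniusClosing (chartSubst)

/-! ## The transform of a series anchor at a rational point of the point blow-up (ring level) -/

section Transform

variable {p : ℕ} [hp : Fact p.Prime] {K : Type} [Field K] [CharP K p] [PerfectRing K p] [DecidableEq K]
  {R : Type} [CommRing R] [IsLocalRing R] [IsNoetherianRing R]
  {L : Type} [CommRing L] [IsLocalRing L] [IsNoetherianRing L]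
  (g : R →+* L) (hg : (maximalIdeal R).map g ≤ maximalIdeal L)
  (E₀ : AdicCompletion (maximalIdeal R) R ≃+* MvPowerSeries (Option (Fin 2)) K)
  (c : Option (Fin 2) → R) (hc : Ideal.span (Set.range c) = maximalIdeal R)
  (hcX : ∀ j, E₀ (algebraMap R (AdicCompletion (maximalIdeal R) R) (c j)) - MvPowerSeries.X j ∈
    maximalIdeal (MvPowerSeries (Option (Fin 2)) K) ^ 2)
  {i₀ i₁ : Fin 2} (hi : i₁ ≠ i₀) (htwo : ∀ l, l = i₀ ∨ l = i₁)
  (e : Option (Fin 2) → L) (he : ∀ j, g (c j) = g (c (some i₀)) * e j)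
  (τ : Option (Fin 2) → R)
  (hgen : Ideal.span (Set.range fun j : Option (Fin 2) =>
    if j = some i₀ then g (c (some i₀)) else e j - g (τ j)) = maximalIdeal L)
  (hres : ∀ y : L, ∃ r : R, y - g r ∈ maximalIdeal L)
  (hdim : (Fintype.card (Option (Fin 2)) : WithBot ℕ∞) ≤ ringKrullDim L)

include hg hc he hcX hgen hres hdim hi htwo in
/-- [OURS · L1 W4.6 rung (iii-2) — FORMAL ENTRANCE DOOR for power-series residuals, the ring-level step; replaces the role of «the transform
`E′` of `E` by the blowup with center `D`» (H. Hironaka, ms. 2017, Def. 2.1 p.5) for a formally purely inseparable germ `z^p + F(u)`, `F` ANY power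
series, at a rational point of the point blow-up; NOT a statement of the manuscript] **The controlled transform of a series anchor is the series
anchor of the series model's step.** Under the hypotheses of gen 5's `exists_ringEquiv_transform_anchor` with the anchor `E₀(f₀) = w₀ · (z^p + F(u))`,
`F = S₀.F` a power series of order `o ≥ p`, and `g f₀ = g(c_{i₀})^p · f′`, `f′ ∈ 𝔪_L^p`: there are Cohen coordinates `E′` at the point with
`E′(f′) = w′ · (z^p + F′(u))`, `F′ = (S₀.step p i₀ b).F` the SERIES STEP at the translated point `b = (i₀ ↦ 0, i₁ ↦ τ_{i₁}(0))`, an EQUIMULTIPLE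
point of the series model. [cite: Matsumura1987, Thm. 8.11] [cite: Hauser2010, §§F–G (point blowup followed by cleaning)] -/
theorem exists_ringEquiv_transform_seriesAnchor (S₀ : Series (Fin 2) K) {o : ℕ} (ho : S₀.F.order = o) (hpo : p ≤ o) (f₀ : R)
    (w₀ : MvPowerSeries (Option (Fin 2)) K) (hw₀ : IsUnit w₀)
    (hf₀ : E₀ (algebraMap R (AdicCompletion (maximalIdeal R) R) f₀) =
      w₀ * (MvPowerSeries.X none ^ p + MvPowerSeries.rename (some : Fin 2 → Option (Fin 2)) S₀.F))
    (hHW : i₀ = 1 → MvPowerSeries.constantCoeff (E₀ (algebraMap R (AdicCompletion (maximalIdeal R) R) (τ (some 0)))) = 0)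
    (f' : L) (hf' : g f₀ = g (c (some i₀)) ^ p * f') (hf'𝔪 : f' ∈ maximalIdeal L ^ p) :
    ∃ (E' : AdicCompletion (maximalIdeal L) L ≃+* MvPowerSeries (Option (Fin 2)) K)
      (w' : MvPowerSeries (Option (Fin 2)) K) (b : Fin 2 → K), IsUnit w' ∧
      b i₀ = 0 ∧ (i₀ = 1 → ∀ l, b l = 0) ∧ b i₁ = MvPowerSeries.constantCoeff (E₀ (algebraMap R (AdicCompletion (maximalIdeal R) R) (τ (some i₁)))) ∧
      S₀.IsEquimultiplePoint p i₀ b ∧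
      E' (algebraMap L (AdicCompletion (maximalIdeal L) L) f') =
        w' * (MvPowerSeries.X none ^ p + MvPowerSeries.rename (some : Fin 2 → Option (Fin 2)) (S₀.step p i₀ b).F) := by
  classical
  -- notation
  set ĝ := adicCompletionMap (maximalIdeal R) (maximalIdeal L) g hg with hĝ
  set φ : (MvPowerSeries (Option (Fin 2)) K) →+* AdicCompletion (maximalIdeal L) L := ĝ.comp E₀.symm.toRingHom with hφ
  set ofL := algebraMap L (AdicCompletion (maximalIdeal L) L) with hofL
  set ofR := algebraMap R (AdicCompletion (maximalIdeal R) R) with hofR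
  set τκ : Fin 2 → K := fun j => MvPowerSeries.constantCoeff (E₀ (ofR (τ (some j)))) with hτκ
  set ζ : K := MvPowerSeries.constantCoeff (E₀ (ofR (τ none))) with hζ
  have hφE₀ : ∀ x, φ (E₀ x) = ĝ x := fun x => by
    rw [hφ, RingHom.comp_apply]
    change ĝ (E₀.symm (E₀ x)) = ĝ x
    rw [RingEquiv.symm_apply_apply]
  have hĝ_of : ∀ x : R, ĝ (ofR x) = ofL (g x) := fun x => by
    rw [hofR, hofL, hĝ, adicCompletionMap_algebraMap]
  haveI : IsNoetherianRing (AdicCompletion (maximalIdeal L) L) := isNoetherianRing_adicCompletion_maximalIdeal L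
  haveI : CharP (MvPowerSeries (Option (Fin 2)) K) p := charP_of_injective_algebraMap (algebraMap K (MvPowerSeries (Option (Fin 2)) K)).injective p
  -- the translated point in the Hauser–Wagner frame and the cleaning series
  set b : Fin 2 → K := fun l => if l = i₀ then 0 else τκ i₁ with hb
  have hbi₀ : b i₀ = 0 := by rw [hb]; exact if_pos rfl
  have hbi₁ : b i₁ = τκ i₁ := by rw [hb]; exact if_neg hi
  obtain ⟨Q, hQ⟩ := Series.exists_add_pow_eq_step_F p i₀ b S₀ (ζ ^ p)
  -- `hQ : S₀.pointTransform p i₀ b + C (ζ^p) + Q ^ p = (S₀.step p i₀ b).F`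
  set q₀ : K := MvPowerSeries.constantCoeff Q with hq₀
  -- the shear series: the placed series `Q − q₀`
  set sh : (MvPowerSeries (Option (Fin 2)) K) := MvPowerSeries.rename (some : Fin 2 → Option (Fin 2)) Q - MvPowerSeries.C q₀ with hsh
  have hsh0 : MvPowerSeries.constantCoeff sh = 0 := by
    rw [hsh, map_sub, constantCoeff_rename_some, MvPowerSeries.constantCoeff_C, hq₀, sub_self]
  have hsh_kill : MvPowerSeries.subst (fun j : Option (Fin 2) => if j = none then (0 : (MvPowerSeries (Option (Fin 2)) K)) else MvPowerSeries.X j) sh = sh := by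
    rw [hsh, hq₀]; exact kill_rename_sub_C Q
  -- STEP 1: the sheared chart `E'`
  obtain ⟨E', hE'C, hE'i, hE'j, hE'z⟩ :=
    exists_ringEquiv_completion_chart_shear g hg E₀ c hc hcX (some i₀) e he τ hgen hres hdim none
      (Option.some_ne_none i₀).symm sh hsh0 hsh_kill
  set ψ : (MvPowerSeries (Option (Fin 2)) K) →+* (MvPowerSeries (Option (Fin 2)) K) := (E' : _ →+* (MvPowerSeries (Option (Fin 2)) K)).comp φ with hψ
  have hψapp : ∀ x, ψ x = E' (φ x) := fun x => rfl
  have hψC : ∀ l, ψ (MvPowerSeries.C l) = MvPowerSeries.C l := fun l => hE'C l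
  have hψi : ψ (MvPowerSeries.X (some i₀)) = MvPowerSeries.X (some i₀) := hE'i
  have hψj : ψ (MvPowerSeries.X (some i₁)) = MvPowerSeries.X (some i₀) * (MvPowerSeries.X (some i₁) + MvPowerSeries.C (τκ i₁)) :=
    hE'j (some i₁) (fun h => hi (Option.some_injective _ h)) (Option.some_ne_none i₁)
  have hψz : ψ (MvPowerSeries.X none) = MvPowerSeries.X (some i₀) * (MvPowerSeries.X none + sh + MvPowerSeries.C ζ) := by
    rw [hψapp, hE'z, hζ, hofR]; ring
  -- STEP 2: `ψ` is the germ chart substitution; the anchor identity through `Series.subst_chartSubst_eq`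
  set r : MvPowerSeries (Fin 2) K := (Q - MvPowerSeries.C q₀) + MvPowerSeries.C ζ with hr
  have hr_ren : MvPowerSeries.rename (some : Fin 2 → Option (Fin 2)) r = sh + MvPowerSeries.C ζ := by
    rw [hr, map_add, map_sub, MvPowerSeries.rename_C, MvPowerSeries.rename_C, hsh]
  have hψz' : ψ (MvPowerSeries.X none) = MvPowerSeries.X (some i₀) * (MvPowerSeries.X none + MvPowerSeries.rename (some : Fin 2 → Option (Fin 2)) r) := by
    rw [hψz, hr_ren]; ring
  have hψj' : ∀ j : Fin 2, j ≠ i₀ → ψ (MvPowerSeries.X (some j)) = MvPowerSeries.X (some i₀) * (MvPowerSeries.X (some j) + MvPowerSeries.C (τκ j)) := by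
    intro j hj
    rcases htwo j with rfl | rfl
    · exact absurd rfl hj
    · exact hψj
  set σ' : Option (Fin 2) → (MvPowerSeries (Option (Fin 2)) K) := fun o => o.elim (MvPowerSeries.X (some i₀) * (MvPowerSeries.X none + MvPowerSeries.rename (some : Fin 2 → Option (Fin 2)) r))
    (fun j => MvPowerSeries.rename (some : Fin 2 → Option (Fin 2)) (chartSubst 2 K i₀ τκ j)) with hσ'
  have hσ'sub : MvPowerSeries.HasSubst σ' := hasSubst_chartGerm i₀ τκ r
  have hψsubst : ∀ f, ψ f = MvPowerSeries.subst σ' f := fun f => ringHom_eq_subst_chartGerm ψ hψC i₀ τκ r hψi hψj' hψz' f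
  have hψF : ψ (MvPowerSeries.rename (some : Fin 2 → Option (Fin 2)) S₀.F) =
      MvPowerSeries.X (some i₀) ^ p * MvPowerSeries.rename (some : Fin 2 → Option (Fin 2)) (S₀.pointTransform p i₀ b) := by
    rw [hψsubst, hσ', subst_chartGerm_rename i₀ τκ r S₀.F, Series.subst_chartSubst_eq p hi htwo τκ b hbi₀ hbi₁ S₀ ho hpo, map_mul, map_pow,
      MvPowerSeries.rename_X]
  have hA : ψ (w₀ * (MvPowerSeries.X none ^ p + MvPowerSeries.rename (some : Fin 2 → Option (Fin 2)) S₀.F)) =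
      ψ w₀ * (MvPowerSeries.X (some i₀) ^ p * ((MvPowerSeries.X none + sh) ^ p +
        MvPowerSeries.rename (some : Fin 2 → Option (Fin 2)) (S₀.pointTransform p i₀ b + MvPowerSeries.C (ζ ^ p)))) := by
    have h1 : (MvPowerSeries.X (some i₀) * (MvPowerSeries.X none + sh + MvPowerSeries.C ζ)) ^ p =
        MvPowerSeries.X (some i₀) ^ p * ((MvPowerSeries.X none + sh) ^ p + MvPowerSeries.C (ζ ^ p)) := by
      rw [mul_pow, add_pow_char (MvPowerSeries.X none + sh) _ p, map_pow]
    rw [map_mul, map_add, map_pow, hψz, hψF, map_add, MvPowerSeries.rename_C, h1]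
    ring
  -- rewrite the bracket as `z^p + F'(u) − C (q₀^p)`
  have hbracket : (MvPowerSeries.X none + sh) ^ p + MvPowerSeries.rename (some : Fin 2 → Option (Fin 2)) (S₀.pointTransform p i₀ b + MvPowerSeries.C (ζ ^ p)) =
      MvPowerSeries.X none ^ p + MvPowerSeries.rename (some : Fin 2 → Option (Fin 2)) (S₀.step p i₀ b).F - MvPowerSeries.C (q₀ ^ p) := by
    rw [← hQ, hsh]
    simp only [map_add, map_pow, MvPowerSeries.rename_C]
    rw [add_pow_char _ _ p, sub_pow_char _ _]
    ring
  rw [hbracket] at hA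
  obtain ⟨G, hG⟩ : ∃ G : MvPowerSeries (Option (Fin 2)) K,
      G = MvPowerSeries.X none ^ p + MvPowerSeries.rename (some : Fin 2 → Option (Fin 2)) (S₀.step p i₀ b).F - MvPowerSeries.C (q₀ ^ p) := ⟨_, rfl⟩
  rw [← hG] at hA
  -- STEP 3: `E′ (g f₀) = ψ(w₀) · X_{i₀}^p · G`
  have hEgf₀ : E' (ofL (g f₀)) = ψ w₀ * (MvPowerSeries.X (some i₀) ^ p * G) := by
    rw [← hĝ_of, ← hφE₀, ← hψapp, hf₀, hA]
  -- STEP 4: `E′ (g c_{i₀}) = X_{i₀} · unit`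
  have hσ'i : σ' (some i₀) = MvPowerSeries.X (some i₀) := rename_chartSubst_self i₀ τκ
  have hσ'mem : ∀ j, σ' j ∈ Ideal.span {(MvPowerSeries.X (some i₀) : (MvPowerSeries (Option (Fin 2)) K))} := by
    intro j
    cases j with
    | none => exact Ideal.mul_mem_right _ _ (Ideal.subset_span rfl)
    | some k =>
      by_cases hk : k = i₀
      · subst hk; rw [hσ'i]; exact Ideal.subset_span rfl
      · change MvPowerSeries.rename some (chartSubst 2 K i₀ τκ k) ∈ _
        rw [rename_chartSubst_of_ne i₀ τκ hk]
        exact Ideal.mul_mem_right _ _ (Ideal.subset_span rfl)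
  obtain ⟨w₂, hw₂, hEci⟩ : ∃ w₂ : (MvPowerSeries (Option (Fin 2)) K), IsUnit w₂ ∧ E' (ofL (g (c (some i₀)))) = MvPowerSeries.X (some i₀) * w₂ := by
    obtain ⟨w₂, hw₂, h⟩ := exists_isUnit_image_adapted i₀ hσ'sub hσ'i hσ'mem (E₀ (ofR (c (some i₀)))) (hcX (some i₀))
    exact ⟨w₂, hw₂, by rw [← hĝ_of, ← hφE₀, ← hψapp, hψsubst, h]⟩
  have hw₀' : IsUnit (ψ w₀) := hw₀.map ψ
  -- STEP 5: cancel `X_{i₀}^p`: `w₂^p · E′ f′ = ψ(w₀) · G`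
  have hEf' : w₂ ^ p * E' (ofL f') = ψ w₀ * G := by
    have h1 : E' (ofL (g f₀)) = (MvPowerSeries.X (some i₀) * w₂) ^ p * E' (ofL f') := by
      rw [hf', map_mul, map_pow, map_mul, map_pow, hEci]
    have h2 : (MvPowerSeries.X (some i₀) : (MvPowerSeries (Option (Fin 2)) K)) ^ p * (w₂ ^ p * E' (ofL f')) = MvPowerSeries.X (some i₀) ^ p * (ψ w₀ * G) := by
      rw [← mul_assoc, ← mul_pow, ← h1, hEgf₀]; ring
    exact mul_left_cancel₀ (pow_ne_zero p (X_some_ne_zero i₀)) h2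
  -- STEP 6: singularity upstairs: `G ∈ 𝔪^p`, hence `q₀ = 0` and the point is equimultiple
  have hG𝔪 : G ∈ maximalIdeal (MvPowerSeries (Option (Fin 2)) K) ^ p := by
    have h1 : E' (ofL f') ∈ maximalIdeal (MvPowerSeries (Option (Fin 2)) K) ^ p :=
      ringEquiv_mem_maximalIdeal_pow E' ((mem_maximalIdeal_pow_iff_algebraMap p f').mp hf'𝔪)
    have h2 : ψ w₀ * G ∈ maximalIdeal (MvPowerSeries (Option (Fin 2)) K) ^ p := by rw [← hEf']; exact Ideal.mul_mem_left _ _ h1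
    exact (Ideal.unit_mul_mem_iff_mem _ hw₀').mp h2
  have hXp : (MvPowerSeries.X none : (MvPowerSeries (Option (Fin 2)) K)) ^ p ∈ maximalIdeal (MvPowerSeries (Option (Fin 2)) K) ^ p :=
    Ideal.pow_mem_pow (mem_maximalIdeal_iff_constantCoeff_eq_zero.mpr (MvPowerSeries.constantCoeff_X _)) p
  have hq₀0 : q₀ ^ p = 0 := by
    have hG0 : MvPowerSeries.constantCoeff G = 0 :=
      mem_maximalIdeal_iff_constantCoeff_eq_zero.mp (Ideal.pow_le_self hp.out.ne_zero hG𝔪)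
    have hF'0 : MvPowerSeries.constantCoeff (MvPowerSeries.rename (some : Fin 2 → Option (Fin 2)) (S₀.step p i₀ b).F) = 0 := by
      rw [constantCoeff_rename_some]; exact Series.constantCoeff_step_F p i₀ b S₀
    rw [hG, map_sub, map_add, map_pow, MvPowerSeries.constantCoeff_X, zero_pow hp.out.ne_zero, zero_add, hF'0, zero_sub, MvPowerSeries.constantCoeff_C,
      neg_eq_zero] at hG0
    exact hG0
  have hGeq : G = MvPowerSeries.X none ^ p + MvPowerSeries.rename (some : Fin 2 → Option (Fin 2)) (S₀.step p i₀ b).F := by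
    rw [hG, hq₀0, map_zero, sub_zero]
  have hequi : S₀.IsEquimultiplePoint p i₀ b := by
    -- `(S₀.pointTransform p i₀ b + C ζ^p)(u) = G − z^p − sh^p ∈ 𝔪^p`
    have hsh𝔪 : sh ^ p ∈ maximalIdeal (MvPowerSeries (Option (Fin 2)) K) ^ p := Ideal.pow_mem_pow (mem_maximalIdeal_iff_constantCoeff_eq_zero.mpr hsh0) p
    have hev : MvPowerSeries.rename (some : Fin 2 → Option (Fin 2)) (S₀.pointTransform p i₀ b + MvPowerSeries.C (ζ ^ p)) ∈ maximalIdeal (MvPowerSeries (Option (Fin 2)) K) ^ p := by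
      have hx : MvPowerSeries.rename (some : Fin 2 → Option (Fin 2)) (S₀.pointTransform p i₀ b + MvPowerSeries.C (ζ ^ p)) = G - MvPowerSeries.X none ^ p - sh ^ p := by
        rw [hG, ← hbracket, add_pow_char _ _ p]; ring
      rw [hx]
      exact Ideal.sub_mem _ (Ideal.sub_mem _ hG𝔪 hXp) hsh𝔪
    exact Series.isEquimultiplePoint_of_le_order_add_C p (le_order_of_mem_maximalIdeal_pow (mem_maximalIdeal_pow_of_rename_some hev))
  -- assemble
  obtain ⟨u₂, hu₂⟩ := hw₂.pow p
  refine ⟨E', ↑u₂⁻¹ * ψ w₀, b, (u₂⁻¹.isUnit).mul hw₀', hbi₀, fun h1 l => ?_, hbi₁, hequi, ?_⟩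
  · rcases htwo l with rfl | hl
    · exact hbi₀
    · rw [hl, hbi₁]
      -- `i₀ = 1`, so `i₁ = 0`: the Hauser–Wagner frame condition
      have hi₁ : i₁ = 0 := by
        apply Fin.ext
        have h2 := i₁.isLt
        have h3 : (i₁ : ℕ) ≠ (i₀ : ℕ) := fun h => hi (Fin.ext h)
        rw [h1] at h3
        change (i₁ : ℕ) ≠ 1 at h3
        change (i₁ : ℕ) = 0
        omega
      rw [hi₁]
      exact hHW h1
  · rw [mul_assoc, ← hGeq, ← hEf', ← hu₂, ← mul_assoc, Units.inv_mul, one_mul]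

end Transform

end MohWindowShadeFormalInsep

end CampaignW46

end Summit.ResolutionOfSingularities.ResolutionOfSingularities.Theorems

end
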